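import Summits.CriticalPhenomena.CardyFormulaZ2.Theses.CardyMagicRigidity
import HarnessLib

/-!
# Strategist split of crux `NestingRigidity` (stmt-CriticalPhenomena-4835): BLIND RIGIDITY ∘ ROUTING TRANSFER

Route `CardyMagicRigidity` (sub-problem `CriticalPhenomena/CardyFormulaZ2`), crux
`NestingRigidity ≡ MagicFormulaZ2 → MagicFormulaT → LoopLimitZ2EqT` (by `Iff.rfl`).

WHY.  The certified route gap G4 "routing blindness" (`…TameRigidityWitness` p132831 `not_tame_rigidity`,
`…TameRigidityLaws` p133027 `exists_tame_laws_windEq_le_cnLawEDist`): the pair (trace, winding function, type) of a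
loop does NOT determine the unbased loop — at an interleaved pair of pinch points `p…q…p…q` the two non-crossing
re-routings have the same trace and the same 1-cycle — while DKKMO's `d_CN` (the metric of `LoopLimitZ2EqT`) sees the
routing.  Both hypotheses of the crux (the two magic formulas) and every milestone of the three registered lines
(nesting transforms, tower / pattern counts, typed joint nesting laws, first-generation kernels) are functions of
the BLIND data `{(trace u, {W(u,·) ≠ 0}, type u)}_u`.  Hence every proof of the crux factors through

* `BlindRigidity`   — `MagicFormulaZ2 → MagicFormulaT → LoopLimitZ2Blind` : the magic formulas force BLIND loop
  universality `ℤ² ~ 𝕋` (DKKMO's coupling distance with `d(γ, γ')` replaced by the routing-blind closeness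
  "Hausdorff distance of the traces `≤ ε` and the winding interiors agree off the `ε`-neighbourhood of the traces");
  this child keeps the crux's original open content (transform identities ⇒ interior LAWS) and is the honest target
  of the landed blind machinery (…TreeRigidityTameAssemblyInteriors p132016 etc.);
* `RoutingTransfer` — `LoopLimitZ2Blind → LoopLimitZ2EqT` : blind universality upgrades to `d_CN` universality.
  NEW LEVER (strategist, 2026-08-17): FAIR-COIN ROUTING.  On BOTH lattices the hook-up at a pinch is decided by
  Bernoulli(1/2) bits whose flip is measure-preserving at `p = 1/2` and fixes the 4-arm event (bond-ℤ²: the primal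
  edge through the medial contact vertex; site-𝕋: the contact hexagon); with the 4-arm coupling property
  (Garban–Pete–Schramm arXiv:1008.1378 Prop. 11, valid on ℤ² by RSW, ibid. §1) and the pinch-centred exact symmetries
  (ℤ²: quarter turn about a medial vertex + duality; 𝕋: diagonal reflection + colour flip) the conditional law of the
  hook-up bits given the coarse arc system is asymptotically i.i.d. FAIR on both lattices, so the conditional law of
  the loops given the blind data is ONE lattice-independent kernel and blind closeness of laws transfers to `d_CN`
  closeness.  Continuum shadow: Miller–Sheffield–Werner arXiv:1609.04799 Thms 1.1–1.2 (for κ ∈ (4,8) the range does not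
  determine the path; resampling the hook-up at intertwined double points preserves the law).

This module carries, sorry-free: the blind closeness relation and its basic API (§1), the statements of the two
children exactly as filed on the route (§2), the GLUE `nestingRigidity_of_subs : BlindRigidity → RoutingTransfer →
NestingRigidity` (§3, the `--glue-by` theorem of the split), and the soundness direction `LoopLimitZ2EqT →
LoopLimitZ2Blind` (§4: `d_CN`-closeness implies blind closeness — `udist`-stability of winding numbers — so
`BlindRigidity` is implied by the crux and `RoutingTransfer` carries exactly the routing content).
-/

noncomputable section

open MeasureTheory Filter Set Topology
open scoped ENNReal
open Literature.Probability.RandomPlanarGeometry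

namespace Summit.CriticalPhenomena.CardyFormulaZ2.Cruxes.NestingRigidity.FairCoinRouting

open Summit.CriticalPhenomena.CardyFormulaZ2.Theses.CardyMagicRigidity

/-! ## §1 Routing-blind closeness of typed loop configurations -/

/-- **Blind closeness of two loops at precision `ε`**: Hausdorff distance of the traces `≤ ε` and the winding
INTERIORS `{W ≠ 0}` agree off the closed `ε`-neighbourhood of the two traces.  Orientation, multiplicity and the
ROUTING at pinch points are invisible to it (two re-routings of one trace with the same 1-cycle are blind-close at
every `ε ≥ 0`). -/
def BlindNear (ε : ℝ) (u u' : UnbasedLoop ℂ) : Prop :=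
  Metric.hausdorffEDist u.range u'.range ≤ ENNReal.ofReal ε ∧
    symmDiff {z : ℂ | u.wind z ≠ 0} {z : ℂ | u'.wind z ≠ 0} ⊆ Metric.cthickening ε (u.range ∪ u'.range)

/-- **The blind analogue of DKKMO's relation `d_CN(F, F') ≤ ε`** (`LoopConfig.IsClose` with `udist ≤ ε` replaced
by `BlindNear ε`): every loop of either configuration inside the window `B(0, 1/ε)` has a blind-close loop OF THE
SAME TYPE in the other configuration. -/
def IsBlindClose (ε : ℝ) (c c' : LoopConfig ℂ) : Prop :=
  ∀ i : Fin 2,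
    (∀ u ∈ c.F i, u.range ⊆ Metric.ball (0 : ℂ) (1 / ε) → ∃ u' ∈ c'.F i, BlindNear ε u u') ∧
    (∀ u' ∈ c'.F i, u'.range ⊆ Metric.ball (0 : ℂ) (1 / ε) → ∃ u ∈ c.F i, BlindNear ε u' u)

variable {Ω Ω' : Type*} [MeasurableSpace Ω] [MeasurableSpace Ω']

/-- **Blind coupling distance of laws** (DKKMO eq. (2) with `IsClose` replaced by `IsBlindClose`). -/
def blindLawEDist (μ : Measure Ω) (X : Ω → LoopConfig ℂ) (μ' : Measure Ω') (X' : Ω' → LoopConfig ℂ) : ℝ≥0∞ :=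
  ⨅ (ε : ℝ) (_ : 0 < ε) (P : Measure (Ω × Ω')) (_ : P.map Prod.fst = μ) (_ : P.map Prod.snd = μ')
    (_ : P {p | ¬ IsBlindClose ε (X p.1) (X' p.2)} < ENNReal.ofReal ε), ENNReal.ofReal ε

/-! ### `udist`-closeness implies blind closeness -/

/-- A loop at unoriented distance `≤ ε` is blind-close at precision `ε`: the Hausdorff distance of the traces is
dominated by `udist`, and off the `ε`-neighbourhood of the trace the winding numbers agree up to a global sign
(`UnbasedLoop.wind_eq_or_eq_neg_of_udist_lt`), so the interiors `{W ≠ 0}` agree there. -/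
theorem blindNear_of_udist_le {ε : ℝ} {u u' : UnbasedLoop ℂ} (h : u.udist u' ≤ ε) : BlindNear ε u u' := by
  have hε : 0 ≤ ε := (UnbasedLoop.udist_nonneg u u').trans h
  refine ⟨?_, ?_⟩
  · have hfin : Metric.hausdorffEDist u.range u'.range ≠ ⊤ :=
      Metric.hausdorffEDist_ne_top_of_nonempty_of_bounded u.range_nonempty u'.range_nonempty
        u.isCompact_range.isBounded u'.isCompact_range.isBounded
    have hreal : Metric.hausdorffDist u.range u'.range ≤ ε := (UnbasedLoop.hausdorffDist_range_le_udist u u').trans h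
    rw [← ENNReal.ofReal_toReal hfin]
    exact ENNReal.ofReal_le_ofReal hreal
  · intro z hz
    by_contra hzt
    rw [Metric.mem_cthickening_iff, not_le, Metric.infEDist_union, lt_inf_iff] at hzt
    have hzu : ε < Metric.infDist z u.range := by
      have h1 : ENNReal.ofReal ε < Metric.infEDist z u.range := hzt.1
      have hne : Metric.infEDist z u.range ≠ ⊤ := Metric.infEDist_ne_top u.range_nonempty
      rw [Metric.infDist, ← ENNReal.toReal_ofReal hε]
      exact (ENNReal.toReal_lt_toReal ENNReal.ofReal_ne_top hne).2 h1
    have hw := UnbasedLoop.wind_eq_or_eq_neg_of_udist_lt (h.trans_lt hzu)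
    have hiff : (u.wind z ≠ 0 ↔ u'.wind z ≠ 0) := by
      rcases hw with hw | hw <;> simp [hw]
    simp only [Set.mem_symmDiff, Set.mem_setOf_eq] at hz
    tauto

/-- **`d_CN(F, F') ≤ ε` implies blind closeness at precision `ε`.** -/
theorem isBlindClose_of_isClose {ε : ℝ} {c c' : LoopConfig ℂ} (h : LoopConfig.IsClose ε c c') :
    IsBlindClose ε c c' := by
  intro i
  refine ⟨fun u hu hr ↦ ?_, fun u' hu' hr ↦ ?_⟩
  · obtain ⟨u', hu', hd⟩ := (h i).1 u hu hr
    exact ⟨u', hu', blindNear_of_udist_le hd⟩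
  · obtain ⟨u, hu, hd⟩ := (h i).2 u' hu' hr
    exact ⟨u, hu, blindNear_of_udist_le hd⟩

/-- **The blind coupling distance is dominated by DKKMO's coupling distance** (same couplings, larger good event). -/
theorem blindLawEDist_le_cnLawEDist (μ : Measure Ω) (X : Ω → LoopConfig ℂ) (μ' : Measure Ω')
    (X' : Ω' → LoopConfig ℂ) : blindLawEDist μ X μ' X' ≤ LoopConfig.cnLawEDist μ X μ' X' := by
  refine le_iInf fun ε ↦ le_iInf fun hε ↦ le_iInf fun P ↦ le_iInf fun h₁ ↦ le_iInf fun h₂ ↦ le_iInf fun hP ↦ ?_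
  refine (iInf_le _ ε).trans <| (iInf_le _ hε).trans <| (iInf_le _ P).trans <| (iInf_le _ h₁).trans <|
    (iInf_le _ h₂).trans <| iInf_le _ ?_
  refine lt_of_le_of_lt (measure_mono ?_) hP
  intro p hp hc
  exact hp (isBlindClose_of_isClose hc)

/-- What blind closeness forgets: configurations whose loops correspond type by type with EQUAL traces and EQUAL
winding interiors are blind-close at every precision `ε` — e.g. the two re-routings of the two-mouth lake of
`…TameRigidityWitness` (p132831), which are at `udist ≥ 1/2`. -/
theorem isBlindClose_of_forall_exists_eq {ε : ℝ} {c c' : LoopConfig ℂ}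
    (h₁ : ∀ i, ∀ u ∈ c.F i, ∃ u' ∈ c'.F i, u'.range = u.range ∧ {z | u'.wind z ≠ 0} = {z | u.wind z ≠ 0})
    (h₂ : ∀ i, ∀ u' ∈ c'.F i, ∃ u ∈ c.F i, u.range = u'.range ∧ {z | u.wind z ≠ 0} = {z | u'.wind z ≠ 0}) :
    IsBlindClose ε c c' := by
  have key : ∀ u u' : UnbasedLoop ℂ, u'.range = u.range → {z | u'.wind z ≠ 0} = {z | u.wind z ≠ 0} →
      BlindNear ε u u' := by
    intro u u' hr hw
    refine ⟨?_, ?_⟩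
    · rw [hr, Metric.hausdorffEDist_self]; exact bot_le
    · rw [hw, symmDiff_self]; exact Set.empty_subset _
  intro i
  refine ⟨fun u hu _ ↦ ?_, fun u' hu' _ ↦ ?_⟩
  · obtain ⟨u', hu', hr, hw⟩ := h₁ i u hu
    exact ⟨u', hu', key u u' hr hw⟩
  · obtain ⟨u, hu, hr, hw⟩ := h₂ i u' hu'
    exact ⟨u, hu, key u' u hr hw⟩

/-! ## §2 The two children of the split, exactly as filed on the route -/

/-- **Blind loop universality `ℤ² ~ 𝕋`** (`LoopLimitZ2Blind`): the blind coupling distance between the full-plane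
loop configuration of critical bond percolation on `δℤ²` and that of critical site percolation on `δ𝕋` tends to `0`
as `δ → 0⁺` — the statement `LoopLimitZ2EqT` with DKKMO's `d(γ, γ') ≤ ε` replaced by `BlindNear ε` (written out over
Literature declarations, literally the term filed on the route). -/
def LoopLimitZ2Blind : Prop :=
  Filter.Tendsto (fun δ : ℝ ↦ ⨅ (ε : ℝ) (_ : 0 < ε) (P : MeasureTheory.Measure (Literature.Probability.Percolation.BondConfig (Literature.Probability.LatticeModels.Site 2) × Literature.Probability.Percolation.SiteConfig (Literature.Probability.LatticeModels.Site 2))) (_ : P.map Prod.fst = Literature.Probability.Percolation.bondPercolation (Literature.Probability.LatticeModels.zdGraph 2) Literature.Probability.Percolation.half) (_ : P.map Prod.snd = Literature.Probability.LatticeModels.triSitePercolation Literature.Probability.Percolation.half) (_ : P {p | ¬ (∀ i : Fin 2, (∀ u ∈ (Literature.Probability.Percolation.bondLoopConfig δ 0 p.1).F i, u.range ⊆ Metric.ball (0 : ℂ) (1 / ε) → ∃ u' ∈ (⟨fun i ↦ {u : Literature.Probability.RandomPlanarGeometry.UnbasedLoop ℂ | ∃ (v : Literature.Probability.LatticeModels.HexVertex)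 (γ : Literature.Probability.LatticeModels.hexGraph.Walk v v), Literature.Probability.Percolation.IsSiteInterfaceLoop p.2 γ ∧ (i = 1 ↔ 0 < Literature.Probability.Percolation.shoelace (γ.support.map Literature.Probability.LatticeModels.hexCenter)) ∧ u = Literature.Probability.RandomPlanarGeometry.UnbasedLoop.mk (Literature.Probability.RandomPlanarGeometry.BasedLoop.mk (Literature.Probability.Percolation.siteLoopCurve δ γ) (Literature.Probability.Percolation.isLoop_siteLoopCurve δ γ))}⟩ : Literature.Probability.RandomPlanarGeometry.LoopConfig ℂ).F i, Metric.hausdorffEDist u.range u'.range ≤ ENNReal.ofReal ε ∧ symmDiff {z : ℂ | u.wind z ≠ 0} {z : ℂ | u'.wind z ≠ 0} ⊆ Metric.cthickening ε (u.range ∪ u'.range)) ∧ (∀ u' ∈ (⟨fun i ↦ {u : Literature.Probability.RandomPlanarGeometry.UnbasedLoop ℂ | ∃ (v : Literature.Probability.LatticeModels.HexVertex) (γ : Literature.Probability.LatticeModels.hexGraph.Walk v v), Literature.Probability.Percolation.IsSiteInterfaceLoop p.2 γ ∧ (i = 1 ↔ 0 < Literature.Probability.Percolation.shoelace (γ.support.map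 Literature.Probability.LatticeModels.hexCenter)) ∧ u = Literature.Probability.RandomPlanarGeometry.UnbasedLoop.mk (Literature.Probability.RandomPlanarGeometry.BasedLoop.mk (Literature.Probability.Percolation.siteLoopCurve δ γ) (Literature.Probability.Percolation.isLoop_siteLoopCurve δ γ))}⟩ : Literature.Probability.RandomPlanarGeometry.LoopConfig ℂ).F i, u'.range ⊆ Metric.ball (0 : ℂ) (1 / ε) → ∃ u ∈ (Literature.Probability.Percolation.bondLoopConfig δ 0 p.1).F i, Metric.hausdorffEDist u'.range u.range ≤ ENNReal.ofReal ε ∧ symmDiff {z : ℂ | u'.wind z ≠ 0} {z : ℂ | u.wind z ≠ 0} ⊆ Metric.cthickening ε (u'.range ∪ u.range)))} < ENNReal.ofReal ε), ENNReal.ofReal ε) (nhdsWithin 0 (Set.Ioi 0)) (nhds 0)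

/-- Child 1, **`BlindRigidity`** (the crux's original open content, routing-free): the two magic formulas force
BLIND loop universality. -/
def BlindRigidityStatement : Prop := MagicFormulaZ2 → MagicFormulaT → LoopLimitZ2Blind

/-- Child 2, **`RoutingTransfer`** (the fair-coin routing lemma): blind loop universality upgrades to DKKMO's
`d_CN` universality `LoopLimitZ2EqT`. -/
def RoutingTransferStatement : Prop := LoopLimitZ2Blind → LoopLimitZ2EqT

/-- The random site-`𝕋` configuration of the target, named (orientation-typed honeycomb interface loops). -/
def triCfg (δ : ℝ) (cfg : Literature.Probability.Percolation.SiteConfig (Literature.Probability.LatticeModels.Site 2)) :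
    LoopConfig ℂ :=
  ⟨fun i ↦ {u : UnbasedLoop ℂ | ∃ (v : Literature.Probability.LatticeModels.HexVertex)
    (γ : Literature.Probability.LatticeModels.hexGraph.Walk v v),
    Literature.Probability.Percolation.IsSiteInterfaceLoop cfg γ ∧
      (i = 1 ↔ 0 < Literature.Probability.Percolation.shoelace (γ.support.map Literature.Probability.LatticeModels.hexCenter)) ∧
      u = UnbasedLoop.mk (BasedLoop.mk (Literature.Probability.Percolation.siteLoopCurve δ γ)
        (Literature.Probability.Percolation.isLoop_siteLoopCurve δ γ))}⟩

/-- `LoopLimitZ2Blind` is literally `blindLawEDist (bond-ℤ² law, loops) (site-𝕋 law, loops) → 0`. -/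
theorem loopLimitZ2Blind_iff :
    LoopLimitZ2Blind ↔ Tendsto (fun δ : ℝ ↦ blindLawEDist
      (Literature.Probability.Percolation.bondPercolation (Literature.Probability.LatticeModels.zdGraph 2)
        Literature.Probability.Percolation.half)
      (Literature.Probability.Percolation.bondLoopConfig δ 0)
      (Literature.Probability.LatticeModels.triSitePercolation Literature.Probability.Percolation.half) (triCfg δ))
      (𝓝[>] 0) (𝓝 0) :=
  Iff.rfl

/-- `LoopLimitZ2EqT` is `cnLawEDist (bond-ℤ² law, loops) (site-𝕋 law, loops) → 0` for the same presentations. -/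
theorem loopLimitZ2EqT_iff :
    LoopLimitZ2EqT ↔ Tendsto (fun δ : ℝ ↦ LoopConfig.cnLawEDist
      (Literature.Probability.Percolation.bondPercolation (Literature.Probability.LatticeModels.zdGraph 2)
        Literature.Probability.Percolation.half)
      (Literature.Probability.Percolation.bondLoopConfig δ 0)
      (Literature.Probability.LatticeModels.triSitePercolation Literature.Probability.Percolation.half) (triCfg δ))
      (𝓝[>] 0) (𝓝 0) :=
  Iff.rfl

/-! ## §3 The glue of the split (pure logic) -/

/-- **GLUE of the strategist split** (`--glue-by`): blind rigidity and routing transfer imply the crux, by name. -/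
theorem nestingRigidity_of_subs : BlindRigidityStatement → RoutingTransferStatement → NestingRigidity := by
  intro h₁ h₂ hZ hT
  exact h₂ (h₁ hZ hT)

/-- The same glue with both children written out (the form the gate elaborates against the route decls). -/
theorem nestingRigidity_of_subs' :
    (MagicFormulaZ2 → MagicFormulaT → LoopLimitZ2Blind) → (LoopLimitZ2Blind → LoopLimitZ2EqT) → NestingRigidity :=
  nestingRigidity_of_subs

/-! ## §4 Soundness of the split: the target implies its blind form -/

/-- **`LoopLimitZ2EqT → LoopLimitZ2Blind`**: `d_CN`-closeness implies blind closeness (squeeze). -/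
theorem loopLimitZ2Blind_of_loopLimitZ2EqT (hX : LoopLimitZ2EqT) : LoopLimitZ2Blind := by
  rw [loopLimitZ2Blind_iff]
  rw [loopLimitZ2EqT_iff] at hX
  exact tendsto_of_tendsto_of_tendsto_of_le_of_le tendsto_const_nhds hX (fun _ ↦ bot_le)
    (fun δ ↦ blindLawEDist_le_cnLawEDist _ _ _ _)

/-- Hence child 1 is implied by the crux (it is the routing-free shadow of `NestingRigidity`) … -/
theorem blindRigidity_of_nestingRigidity (h : NestingRigidity) : BlindRigidityStatement :=
  fun hZ hT ↦ loopLimitZ2Blind_of_loopLimitZ2EqT (h hZ hT)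

/-- … and child 2 is implied by the target alone. -/
theorem routingTransfer_of_loopLimitZ2EqT (hX : LoopLimitZ2EqT) : RoutingTransferStatement := fun _ ↦ hX

end Summit.CriticalPhenomena.CardyFormulaZ2.Cruxes.NestingRigidity.FairCoinRouting

end
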